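import Literature.NumberTheory.Sieve.SmoothParityModelCountLemmas
import HarnessLib

/-!
# The model count of the parity ternary problem: collapse, exact rescaling, size

Topic `Literature/NumberTheory/Sieve`, namespace `Literature.NumberTheory.Sieve.SmoothArcs`; a PROVED tool file for the
circle-method engine of `SmoothParityTernary` ([Harper2016, §5]).  The model count

`parityModelCount σ d₁ d₂ X₁ X₂ X₃ Mv₁ Mv₂ Mv₃ α c₁ c₂ c₃ = Σ_{n₁ ≤ X₁} Σ_{n₂ ≤ X₂} Σ_{n₃ ≤ X₃} 1[d₁n₁ + σd₂n₂ = n₃] μ₁(n₁) μ₂(n₂) conj μ₃(n₃)`,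

`μ_i = profileModelWeight c_i Mv_i X_i α`, is the discrete singular integral of the problem `d₁n₁ + σd₂n₂ = n₃`.  Besides it
we consider its SUBLATTICE SUMS `SUB_t` = the same triple sum over `t ∣ n₁, t ∣ n₂, t ∣ n₃` (written out in full in
every statement; no new definition).  This file proves:

* generic facts on the triple sums over arbitrary index sets `S₁, S₂, S₃`: for REAL profiles they are real
  (`parityModel_summand_eq_ofReal`, `parityModel_tripleSum_eq_ofReal`), for real nonnegative profiles termwise `≥ 0`
  (`parityModel_summand_re_nonneg`, `tripleSum_mono`), and `‖·‖ ≤ #S₁ #S₂ · 64 ΠMv_i/X_i`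
  (`norm_parityModel_tripleSum_le`: at most one `n₃` per `(n₁,n₂)`, `‖μ_i‖ ≤ 4Mv_i/X_i`);
* (MC0) `parityModelCount_eq_sum_sum`: collapse of the `n₃`-sum;
* (MC1) `parityModelCount_rescale` (`_rescale'`): at scales `X_i/t` and masses `Mv_i t^{−α}` the model count equals
  `t³ (t^{−α})³ · SUB_t` EXACTLY (`μ_{Mv t^{−α}, X/t}(m) = t·t^{−α} μ_{Mv,X}(tm)`, `⌊X/t⌋ = ⌊X⌋/t`);
* (MC4) `norm_parityModelCount_le_of_vanish` (`‖MC‖ ≤ 64 Mv₁Mv₂Mv₃/X₃`), `norm_parityModel_sublattice_le`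
  (`‖SUB_t‖ ≤ 64 Mv₁Mv₂Mv₃/(X₃t²)`) for profiles vanishing on `v ≤ 1/4` with `|p| ≤ 1`, `0 ≤ α ≤ 1`.

Positivity and the plateau lower bound (MC3) are in `SmoothParityModelCountPositivity`, the sublattice density (MC2) in
`SmoothParityModelCountDensity`.

## References

* A. J. Harper, Compositio Math. 152 (2016), §5 [Harper2016].
* J. C. Lagarias, K. Soundararajan, Proc. LMS 104 (2012) [LagariasSoundararajan2012] (the conditional `abc` count).
-/

noncomputable section

open Finset

namespace Literature.NumberTheory.Sieve

namespace SmoothArcs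

variable {c₁ c₂ c₃ : ℤ → ℂ}

/-! ### The triple sums over arbitrary index sets -/

/-- For REAL profiles the summand of the model count is the real number
`1[d₁n₁ + σd₂n₂ = n₃] re μ₁(n₁) re μ₂(n₂) re μ₃(n₃)`. [folklore] -/
theorem parityModel_summand_eq_ofReal {c₁ c₂ c₃ : ℤ → ℂ} (hreal₁ : ∀ v, (profileFn c₁ v).im = 0)
    (hreal₂ : ∀ v, (profileFn c₂ v).im = 0) (hreal₃ : ∀ v, (profileFn c₃ v).im = 0) (σ : ℤ) (d₁ d₂ : ℕ)
    (X₁ X₂ X₃ Mv₁ Mv₂ Mv₃ α : ℝ) (n₁ n₂ n₃ : ℕ) :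
    (if (d₁ * n₁ : ℤ) + σ * (d₂ * n₂) = n₃ then
        profileModelWeight c₁ Mv₁ X₁ α n₁ * profileModelWeight c₂ Mv₂ X₂ α n₂ *
          starRingEnd ℂ (profileModelWeight c₃ Mv₃ X₃ α n₃)
      else 0) =
      (((if (d₁ * n₁ : ℤ) + σ * (d₂ * n₂) = n₃ then
          (profileModelWeight c₁ Mv₁ X₁ α n₁).re * (profileModelWeight c₂ Mv₂ X₂ α n₂).re *
            (profileModelWeight c₃ Mv₃ X₃ α n₃).re
        else 0 : ℝ)) : ℂ) := by
  obtain ⟨r₁, e₁⟩ : ∃ r : ℝ, profileModelWeight c₁ Mv₁ X₁ α n₁ = r :=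
    ⟨_, profileModelWeight_eq_ofReal hreal₁ _ _ _ _⟩
  obtain ⟨r₂, e₂⟩ : ∃ r : ℝ, profileModelWeight c₂ Mv₂ X₂ α n₂ = r :=
    ⟨_, profileModelWeight_eq_ofReal hreal₂ _ _ _ _⟩
  obtain ⟨r₃, e₃⟩ : ∃ r : ℝ, profileModelWeight c₃ Mv₃ X₃ α n₃ = r :=
    ⟨_, profileModelWeight_eq_ofReal hreal₃ _ _ _ _⟩
  rw [e₁, e₂, e₃]
  split_ifs
  · rw [Complex.conj_ofReal]
    simp only [Complex.ofReal_re]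
    push_cast
    ring
  · simp

/-- The same for the triple sums over arbitrary finite index sets. [folklore] -/
theorem parityModel_tripleSum_eq_ofReal {c₁ c₂ c₃ : ℤ → ℂ} (hreal₁ : ∀ v, (profileFn c₁ v).im = 0)
    (hreal₂ : ∀ v, (profileFn c₂ v).im = 0) (hreal₃ : ∀ v, (profileFn c₃ v).im = 0) (σ : ℤ) (d₁ d₂ : ℕ)
    (X₁ X₂ X₃ Mv₁ Mv₂ Mv₃ α : ℝ) (S₁ S₂ S₃ : Finset ℕ) :
    (∑ n₁ ∈ S₁, ∑ n₂ ∈ S₂, ∑ n₃ ∈ S₃,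
      if (d₁ * n₁ : ℤ) + σ * (d₂ * n₂) = n₃ then
        profileModelWeight c₁ Mv₁ X₁ α n₁ * profileModelWeight c₂ Mv₂ X₂ α n₂ *
          starRingEnd ℂ (profileModelWeight c₃ Mv₃ X₃ α n₃)
      else 0) =
      ((∑ n₁ ∈ S₁, ∑ n₂ ∈ S₂, ∑ n₃ ∈ S₃,
        (if (d₁ * n₁ : ℤ) + σ * (d₂ * n₂) = n₃ then
          (profileModelWeight c₁ Mv₁ X₁ α n₁).re * (profileModelWeight c₂ Mv₂ X₂ α n₂).re *
            (profileModelWeight c₃ Mv₃ X₃ α n₃).re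
        else 0 : ℝ) : ℝ) : ℂ) := by
  rw [Complex.ofReal_sum]
  refine Finset.sum_congr rfl fun n₁ _ => ?_
  rw [Complex.ofReal_sum]
  refine Finset.sum_congr rfl fun n₂ _ => ?_
  rw [Complex.ofReal_sum]
  exact Finset.sum_congr rfl fun n₃ _ => parityModel_summand_eq_ofReal hreal₁ hreal₂ hreal₃ σ d₁ d₂ _ _ _ _ _ _ _ _ _ _

/-- For real NONNEGATIVE profiles (`Mv_i ≥ 0`, `X_i ≥ 0`) the real summand is `≥ 0`. [folklore] -/
theorem parityModel_summand_re_nonneg {c₁ c₂ c₃ : ℤ → ℂ} (hpos₁ : ∀ v, 0 ≤ (profileFn c₁ v).re)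
    (hpos₂ : ∀ v, 0 ≤ (profileFn c₂ v).re) (hpos₃ : ∀ v, 0 ≤ (profileFn c₃ v).re) (σ : ℤ) (d₁ d₂ : ℕ)
    {X₁ X₂ X₃ Mv₁ Mv₂ Mv₃ : ℝ} (hMv₁ : 0 ≤ Mv₁) (hMv₂ : 0 ≤ Mv₂) (hMv₃ : 0 ≤ Mv₃) (hX₁ : 0 ≤ X₁)
    (hX₂ : 0 ≤ X₂) (hX₃ : 0 ≤ X₃) (α : ℝ) (n₁ n₂ n₃ : ℕ) :
    0 ≤ (if (d₁ * n₁ : ℤ) + σ * (d₂ * n₂) = n₃ then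
          (profileModelWeight c₁ Mv₁ X₁ α n₁).re * (profileModelWeight c₂ Mv₂ X₂ α n₂).re *
            (profileModelWeight c₃ Mv₃ X₃ α n₃).re
        else 0 : ℝ) := by
  split_ifs
  · exact mul_nonneg (mul_nonneg (profileModelWeight_re_nonneg hpos₁ hMv₁ hX₁ α n₁)
      (profileModelWeight_re_nonneg hpos₂ hMv₂ hX₂ α n₂)) (profileModelWeight_re_nonneg hpos₃ hMv₃ hX₃ α n₃)
  · exact le_rfl

/-- Monotonicity of a triple sum of nonnegative reals in its index sets. [folklore] -/
theorem tripleSum_mono {f : ℕ → ℕ → ℕ → ℝ} (hf : ∀ n₁ n₂ n₃, 0 ≤ f n₁ n₂ n₃) {S₁ S₁' S₂ S₂' S₃ S₃' : Finset ℕ}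
    (h₁ : S₁' ⊆ S₁) (h₂ : S₂' ⊆ S₂) (h₃ : S₃' ⊆ S₃) :
    ∑ n₁ ∈ S₁', ∑ n₂ ∈ S₂', ∑ n₃ ∈ S₃', f n₁ n₂ n₃ ≤ ∑ n₁ ∈ S₁, ∑ n₂ ∈ S₂, ∑ n₃ ∈ S₃, f n₁ n₂ n₃ := by
  calc ∑ n₁ ∈ S₁', ∑ n₂ ∈ S₂', ∑ n₃ ∈ S₃', f n₁ n₂ n₃ ≤ ∑ n₁ ∈ S₁', ∑ n₂ ∈ S₂', ∑ n₃ ∈ S₃, f n₁ n₂ n₃ :=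
        Finset.sum_le_sum fun n₁ _ => Finset.sum_le_sum fun n₂ _ =>
          Finset.sum_le_sum_of_subset_of_nonneg h₃ fun n₃ _ _ => hf n₁ n₂ n₃
    _ ≤ ∑ n₁ ∈ S₁', ∑ n₂ ∈ S₂, ∑ n₃ ∈ S₃, f n₁ n₂ n₃ :=
        Finset.sum_le_sum fun n₁ _ =>
          Finset.sum_le_sum_of_subset_of_nonneg h₂ fun n₂ _ _ => Finset.sum_nonneg fun n₃ _ => hf n₁ n₂ n₃
    _ ≤ ∑ n₁ ∈ S₁, ∑ n₂ ∈ S₂, ∑ n₃ ∈ S₃, f n₁ n₂ n₃ :=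
        Finset.sum_le_sum_of_subset_of_nonneg h₁ fun n₁ _ _ =>
          Finset.sum_nonneg fun n₂ _ => Finset.sum_nonneg fun n₃ _ => hf n₁ n₂ n₃

/-- **Crude size of the triple sums**: at most one `n₃` per `(n₁, n₂)` and `‖μ_i‖ ≤ 4Mv_i/X_i`, so over index sets
`S₁, S₂, S₃` the triple sum has norm `≤ #S₁ · #S₂ · 64 (Mv₁/X₁)(Mv₂/X₂)(Mv₃/X₃)`. [folklore] -/
theorem norm_parityModel_tripleSum_le {c₁ c₂ c₃ : ℤ → ℂ} {X₁ X₂ X₃ Mv₁ Mv₂ Mv₃ α : ℝ}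
    (h0₁ : ∀ v : ℝ, v ≤ 1 / 4 → profileFn c₁ v = 0) (h0₂ : ∀ v : ℝ, v ≤ 1 / 4 → profileFn c₂ v = 0)
    (h0₃ : ∀ v : ℝ, v ≤ 1 / 4 → profileFn c₃ v = 0) (h1₁ : ∀ v, ‖profileFn c₁ v‖ ≤ 1)
    (h1₂ : ∀ v, ‖profileFn c₂ v‖ ≤ 1) (h1₃ : ∀ v, ‖profileFn c₃ v‖ ≤ 1) (hα0 : 0 ≤ α) (hα1 : α ≤ 1)
    (hMv₁ : 0 ≤ Mv₁) (hMv₂ : 0 ≤ Mv₂) (hMv₃ : 0 ≤ Mv₃) (hX₁ : 0 < X₁) (hX₂ : 0 < X₂) (hX₃ : 0 < X₃)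
    (σ : ℤ) (d₁ d₂ : ℕ) (S₁ S₂ S₃ : Finset ℕ) :
    ‖∑ n₁ ∈ S₁, ∑ n₂ ∈ S₂, ∑ n₃ ∈ S₃,
      if (d₁ * n₁ : ℤ) + σ * (d₂ * n₂) = n₃ then
        profileModelWeight c₁ Mv₁ X₁ α n₁ * profileModelWeight c₂ Mv₂ X₂ α n₂ *
          starRingEnd ℂ (profileModelWeight c₃ Mv₃ X₃ α n₃)
      else 0‖ ≤ S₁.card * S₂.card * (64 * (Mv₁ / X₁ * (Mv₂ / X₂) * (Mv₃ / X₃))) := by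
  have hB : 0 ≤ 4 * (Mv₁ / X₁) * (4 * (Mv₂ / X₂)) * (4 * (Mv₃ / X₃)) := by positivity
  calc ‖∑ n₁ ∈ S₁, ∑ n₂ ∈ S₂, ∑ n₃ ∈ S₃,
        if (d₁ * n₁ : ℤ) + σ * (d₂ * n₂) = n₃ then
          profileModelWeight c₁ Mv₁ X₁ α n₁ * profileModelWeight c₂ Mv₂ X₂ α n₂ *
            starRingEnd ℂ (profileModelWeight c₃ Mv₃ X₃ α n₃)
        else 0‖
      ≤ ∑ n₁ ∈ S₁, ∑ n₂ ∈ S₂, 4 * (Mv₁ / X₁) * (4 * (Mv₂ / X₂)) * (4 * (Mv₃ / X₃)) := by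
        refine norm_sum_le_of_le _ fun n₁ _ => norm_sum_le_of_le _ fun n₂ _ => ?_
        rw [sum_ite_intCast_eq]
        split_ifs
        · rw [norm_mul, norm_mul, Complex.norm_conj]
          exact mul_le_mul (mul_le_mul (norm_profileModelWeight_le_four_mul h0₁ h1₁ hα0 hα1 hMv₁ hX₁ _)
            (norm_profileModelWeight_le_four_mul h0₂ h1₂ hα0 hα1 hMv₂ hX₂ _) (norm_nonneg _) (by positivity))
            (norm_profileModelWeight_le_four_mul h0₃ h1₃ hα0 hα1 hMv₃ hX₃ _) (norm_nonneg _) (by positivity)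
        · rw [norm_zero]
          exact hB
    _ = S₁.card * S₂.card * (64 * (Mv₁ / X₁ * (Mv₂ / X₂) * (Mv₃ / X₃))) := by
        simp only [Finset.sum_const, nsmul_eq_mul]
        ring

/-! ### (MC0) Collapsing the `n₃`-sum -/

/-- **(MC0) The model count as a double sum**: the equation determines `n₃ = d₁n₁ + σd₂n₂`, which contributes iff
`1 ≤ d₁n₁ + σd₂n₂ ≤ ⌊X₃⌋`. [cite: Harper2016, §5] -/
theorem parityModelCount_eq_sum_sum (σ : ℤ) (d₁ d₂ : ℕ) (X₁ X₂ X₃ Mv₁ Mv₂ Mv₃ α : ℝ) (c₁ c₂ c₃ : ℤ → ℂ) :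
    parityModelCount σ d₁ d₂ X₁ X₂ X₃ Mv₁ Mv₂ Mv₃ α c₁ c₂ c₃ =
      ∑ n₁ ∈ Icc 1 ⌊X₁⌋₊, ∑ n₂ ∈ Icc 1 ⌊X₂⌋₊,
        if 1 ≤ (d₁ * n₁ : ℤ) + σ * (d₂ * n₂) ∧ (d₁ * n₁ : ℤ) + σ * (d₂ * n₂) ≤ ⌊X₃⌋₊ then
          profileModelWeight c₁ Mv₁ X₁ α n₁ * profileModelWeight c₂ Mv₂ X₂ α n₂ *
            starRingEnd ℂ (profileModelWeight c₃ Mv₃ X₃ α ((d₁ * n₁ : ℤ) + σ * (d₂ * n₂)).toNat)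
        else 0 := by
  unfold parityModelCount
  refine Finset.sum_congr rfl fun n₁ _ => Finset.sum_congr rfl fun n₂ _ => ?_
  exact sum_Icc_ite_intCast_eq ⌊X₃⌋₊ (fun n₃ => profileModelWeight c₁ Mv₁ X₁ α n₁ *
    profileModelWeight c₂ Mv₂ X₂ α n₂ * starRingEnd ℂ (profileModelWeight c₃ Mv₃ X₃ α n₃)) _

/-! ### (MC1) Exact rescaling of all three variables -/

/-- **(MC1) Exact rescaling.**  At the scales `X_i/t` with the masses `Mv_i t^{−α}` (all `t ≥ 1`), the model count is
`t³ (t^{−α})³` times the original triple sum restricted to the sublattice `t ∣ n₁, t ∣ n₂, t ∣ n₃`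
(`μ_{Mv t^{−α}, X/t}(m) = t·t^{−α} μ_{Mv, X}(tm)`, `⌊X/t⌋ = ⌊X⌋/t`, and the equation scales by `t`).
[cite: Harper2016, §5] -/
theorem parityModelCount_rescale (σ : ℤ) (d₁ d₂ : ℕ) (X₁ X₂ X₃ Mv₁ Mv₂ Mv₃ α : ℝ) (c₁ c₂ c₃ : ℤ → ℂ) {t : ℕ}
    (ht : 0 < t) :
    parityModelCount σ d₁ d₂ (X₁ / t) (X₂ / t) (X₃ / t) (Mv₁ * (t : ℝ) ^ (-α)) (Mv₂ * (t : ℝ) ^ (-α))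
        (Mv₃ * (t : ℝ) ^ (-α)) α c₁ c₂ c₃ =
      (t : ℂ) ^ 3 * (((t : ℝ) ^ (-α) : ℝ) : ℂ) ^ 3 *
        ∑ n₁ ∈ (Icc 1 ⌊X₁⌋₊).filter (t ∣ ·), ∑ n₂ ∈ (Icc 1 ⌊X₂⌋₊).filter (t ∣ ·),
          ∑ n₃ ∈ (Icc 1 ⌊X₃⌋₊).filter (t ∣ ·),
            if (d₁ * n₁ : ℤ) + σ * (d₂ * n₂) = n₃ then
              profileModelWeight c₁ Mv₁ X₁ α n₁ * profileModelWeight c₂ Mv₂ X₂ α n₂ *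
                starRingEnd ℂ (profileModelWeight c₃ Mv₃ X₃ α n₃)
            else 0 := by
  have ht' : (t : ℤ) ≠ 0 := by exact_mod_cast ht.ne'
  unfold parityModelCount
  rw [Nat.floor_div_natCast, Nat.floor_div_natCast, Nat.floor_div_natCast]
  simp only [sum_filter_dvd_Icc_eq_sum _ _ ht, profileModelWeight_rescale_rpow, Finset.mul_sum]
  refine Finset.sum_congr rfl fun m₁ _ => Finset.sum_congr rfl fun m₂ _ => Finset.sum_congr rfl fun m₃ _ => ?_
  have hiff : (d₁ * m₁ : ℤ) + σ * (d₂ * m₂) = m₃ ↔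
      (d₁ * (t * m₁ : ℕ) : ℤ) + σ * (d₂ * (t * m₂ : ℕ)) = (t * m₃ : ℕ) := by
    push_cast
    constructor
    · intro h
      linear_combination (t : ℤ) * h
    · intro h
      apply mul_left_cancel₀ ht'
      linear_combination h
  by_cases h : (d₁ * m₁ : ℤ) + σ * (d₂ * m₂) = m₃
  · rw [if_pos h, if_pos (hiff.mp h)]
    simp only [map_mul, map_natCast, Complex.conj_ofReal]
    ring
  · rw [if_neg h, if_neg (mt hiff.mpr h), mul_zero]

/-- (MC1) with the masses written `t^{−α} Mv_i`. [cite: Harper2016, §5] -/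
theorem parityModelCount_rescale' (σ : ℤ) (d₁ d₂ : ℕ) (X₁ X₂ X₃ Mv₁ Mv₂ Mv₃ α : ℝ) (c₁ c₂ c₃ : ℤ → ℂ) {t : ℕ}
    (ht : 0 < t) :
    parityModelCount σ d₁ d₂ (X₁ / t) (X₂ / t) (X₃ / t) ((t : ℝ) ^ (-α) * Mv₁) ((t : ℝ) ^ (-α) * Mv₂)
        ((t : ℝ) ^ (-α) * Mv₃) α c₁ c₂ c₃ =
      (t : ℂ) ^ 3 * (((t : ℝ) ^ (-α) : ℝ) : ℂ) ^ 3 *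
        ∑ n₁ ∈ (Icc 1 ⌊X₁⌋₊).filter (t ∣ ·), ∑ n₂ ∈ (Icc 1 ⌊X₂⌋₊).filter (t ∣ ·),
          ∑ n₃ ∈ (Icc 1 ⌊X₃⌋₊).filter (t ∣ ·),
            if (d₁ * n₁ : ℤ) + σ * (d₂ * n₂) = n₃ then
              profileModelWeight c₁ Mv₁ X₁ α n₁ * profileModelWeight c₂ Mv₂ X₂ α n₂ *
                starRingEnd ℂ (profileModelWeight c₃ Mv₃ X₃ α n₃)
            else 0 := by
  rw [mul_comm _ Mv₁, mul_comm _ Mv₂, mul_comm _ Mv₃]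
  exact parityModelCount_rescale σ d₁ d₂ X₁ X₂ X₃ Mv₁ Mv₂ Mv₃ α c₁ c₂ c₃ ht

/-! ### (MC4) Crude upper bounds -/

/-- **(MC4) Size of the model count**: `‖parityModelCount‖ ≤ 64 Mv₁Mv₂Mv₃/X₃` (profiles vanishing on `v ≤ 1/4`
with `|p| ≤ 1`, `0 ≤ α ≤ 1`, `Mv_i ≥ 0`, `X_i > 0`; `⌊X₁⌋⌊X₂⌋ · 64 ΠMv_i/X_i ≤ 64 ΠMv_i/X₃`). [cite: Harper2016, §5] -/
theorem norm_parityModelCount_le_of_vanish (h0₁ : ∀ v : ℝ, v ≤ 1 / 4 → profileFn c₁ v = 0)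
    (h0₂ : ∀ v : ℝ, v ≤ 1 / 4 → profileFn c₂ v = 0) (h0₃ : ∀ v : ℝ, v ≤ 1 / 4 → profileFn c₃ v = 0)
    (h1₁ : ∀ v, ‖profileFn c₁ v‖ ≤ 1) (h1₂ : ∀ v, ‖profileFn c₂ v‖ ≤ 1) (h1₃ : ∀ v, ‖profileFn c₃ v‖ ≤ 1)
    {α : ℝ} (hα0 : 0 ≤ α) (hα1 : α ≤ 1) {X₁ X₂ X₃ Mv₁ Mv₂ Mv₃ : ℝ} (hMv₁ : 0 ≤ Mv₁) (hMv₂ : 0 ≤ Mv₂)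
    (hMv₃ : 0 ≤ Mv₃) (hX₁ : 0 < X₁) (hX₂ : 0 < X₂) (hX₃ : 0 < X₃) (σ : ℤ) (d₁ d₂ : ℕ) :
    ‖parityModelCount σ d₁ d₂ X₁ X₂ X₃ Mv₁ Mv₂ Mv₃ α c₁ c₂ c₃‖ ≤ 64 * (Mv₁ * Mv₂ * Mv₃ / X₃) := by
  unfold parityModelCount
  refine (norm_parityModel_tripleSum_le h0₁ h0₂ h0₃ h1₁ h1₂ h1₃ hα0 hα1 hMv₁ hMv₂ hMv₃ hX₁ hX₂ hX₃ σ d₁ d₂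
    _ _ _).trans ?_
  rw [Nat.card_Icc, Nat.card_Icc, Nat.add_sub_cancel, Nat.add_sub_cancel]
  have h₁ := Nat.floor_le hX₁.le
  have h₂ := Nat.floor_le hX₂.le
  calc (⌊X₁⌋₊ : ℝ) * ⌊X₂⌋₊ * (64 * (Mv₁ / X₁ * (Mv₂ / X₂) * (Mv₃ / X₃)))
      ≤ X₁ * X₂ * (64 * (Mv₁ / X₁ * (Mv₂ / X₂) * (Mv₃ / X₃))) := by gcongr
    _ = 64 * (Mv₁ * Mv₂ * Mv₃ / X₃) := by field_simp

/-- **(MC4) Size of the sublattice sum**: `‖SUB_t‖ ≤ 64 Mv₁Mv₂Mv₃/(X₃ t²)` (`#{n ≤ X_i : t ∣ n} ≤ X_i/t`).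
[cite: Harper2016, §5] -/
theorem norm_parityModel_sublattice_le (h0₁ : ∀ v : ℝ, v ≤ 1 / 4 → profileFn c₁ v = 0)
    (h0₂ : ∀ v : ℝ, v ≤ 1 / 4 → profileFn c₂ v = 0) (h0₃ : ∀ v : ℝ, v ≤ 1 / 4 → profileFn c₃ v = 0)
    (h1₁ : ∀ v, ‖profileFn c₁ v‖ ≤ 1) (h1₂ : ∀ v, ‖profileFn c₂ v‖ ≤ 1) (h1₃ : ∀ v, ‖profileFn c₃ v‖ ≤ 1)
    {α : ℝ} (hα0 : 0 ≤ α) (hα1 : α ≤ 1) {X₁ X₂ X₃ Mv₁ Mv₂ Mv₃ : ℝ} (hMv₁ : 0 ≤ Mv₁) (hMv₂ : 0 ≤ Mv₂)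
    (hMv₃ : 0 ≤ Mv₃) (hX₁ : 0 < X₁) (hX₂ : 0 < X₂) (hX₃ : 0 < X₃) (σ : ℤ) (d₁ d₂ : ℕ) {t : ℕ} (ht : 0 < t) :
    ‖∑ n₁ ∈ (Icc 1 ⌊X₁⌋₊).filter (t ∣ ·), ∑ n₂ ∈ (Icc 1 ⌊X₂⌋₊).filter (t ∣ ·),
        ∑ n₃ ∈ (Icc 1 ⌊X₃⌋₊).filter (t ∣ ·),
          if (d₁ * n₁ : ℤ) + σ * (d₂ * n₂) = n₃ then
            profileModelWeight c₁ Mv₁ X₁ α n₁ * profileModelWeight c₂ Mv₂ X₂ α n₂ *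
              starRingEnd ℂ (profileModelWeight c₃ Mv₃ X₃ α n₃)
          else 0‖ ≤ 64 * (Mv₁ * Mv₂ * Mv₃ / X₃) / (t : ℝ) ^ 2 := by
  refine (norm_parityModel_tripleSum_le h0₁ h0₂ h0₃ h1₁ h1₂ h1₃ hα0 hα1 hMv₁ hMv₂ hMv₃ hX₁ hX₂ hX₃ σ d₁ d₂
    _ _ _).trans ?_
  rw [card_filter_dvd_Icc _ ht, card_filter_dvd_Icc _ ht]
  have ht0 : (0 : ℝ) < t := by exact_mod_cast ht
  have h₁ : ((⌊X₁⌋₊ / t : ℕ) : ℝ) ≤ X₁ / t :=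
    Nat.cast_div_le.trans (div_le_div_of_nonneg_right (Nat.floor_le hX₁.le) ht0.le)
  have h₂ : ((⌊X₂⌋₊ / t : ℕ) : ℝ) ≤ X₂ / t :=
    Nat.cast_div_le.trans (div_le_div_of_nonneg_right (Nat.floor_le hX₂.le) ht0.le)
  calc ((⌊X₁⌋₊ / t : ℕ) : ℝ) * ((⌊X₂⌋₊ / t : ℕ) : ℝ) * (64 * (Mv₁ / X₁ * (Mv₂ / X₂) * (Mv₃ / X₃)))
      ≤ X₁ / t * (X₂ / t) * (64 * (Mv₁ / X₁ * (Mv₂ / X₂) * (Mv₃ / X₃))) := by gcongr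
    _ = 64 * (Mv₁ * Mv₂ * Mv₃ / X₃) / (t : ℝ) ^ 2 := by field_simp

end SmoothArcs

end Literature.NumberTheory.Sieve

end
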